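import Literature.MathematicalPhysics.QuantumFieldTheory.Balaban1983to89.B1Eq324BenfattoSect5CrossCount
import HarnessLib

/-!
# `Balaban1983to89.B1Eq324BenfattoSect5RegionCount` — [BenfattoEtAl1978] §5 p. 159 «Collecting all the errors»: the counting lemmas of
# `B1Eq324BenfattoSect5CrossCount` ANCHORED AT A REGION instead of a point — `Σ_y e^{−c·dist(y,R)} ≤ |R|·K(c,d)` and its `n`-tuple
# (farthest-piece) form `≤ (|R|·K(c/n,d))^n` — the shape the decay-weighted masses of `…TupleClustersDecay` come in — PROVED

statement-level skeleton of published theorems with citation tags; proofs where landed; nothing here is a claim about the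
Yang–Mills mass gap

WHY THIS MODULE (cell `pub-ymgap`, seat `dag-n08-c`, node N08; layer 3 of the assembly).
`B1Eq324BenfattoSect5TupleClustersDecay.abs_ursellOf_tupleSums_condField_le_prod_decayMass` weights every slot's mass by
`e^{−(δ/2k)·ρ(Δ₀)}` for a function `ρ` dominated by the `ℓ¹` distance to the REGION `R_A = □′∖Γ₄(□_m)` (not to a point); the natural
choice `ρ = dist(·, R_A)` is dominated by the distance to SOME tessera of `R_A`, so the lattice sums that make those weighted masses
`O(A)` are the point sums of `…CrossCount` summed over the `|R_A| ≤ b^{2d}` tesserae of the region — a volume factor of one box, as in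
print's `s₂b^{D+2d}A`, uniformly in `|I|`.

WHAT IS PROVED (theorems only; no definition, no named fact, no `sorry`; axioms standard).
* ★ `sum_exp_neg_mul_le_card_mul` — if for every `y ∈ F` some `x ∈ R` has `ℓ¹(x, y) ≤ ρ(y)`, then
  `Σ_{y∈F} e^{−c·ρ(y)} ≤ |R|·K(c, d)`, `K(c,d) = (2/(1−e^{−c/√d})·e^{c/√d})^d` (`c > 0`), uniformly in `F`.
* ★ `sum_piFinset_exp_neg_mul_le_card_mul_pow` — `n`-tuples, `n ≥ 1`: if for every `y ∈ F^n` and every `i` some `x ∈ R` has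
  `ℓ¹(x, y_i) ≤ ρ(y)` (e.g. `ρ(y) = max_i dist(y_i, R)`), then `Σ_{y∈F^n} e^{−c·ρ(y)} ≤ (|R|·K(c/n, d))^n`.
* ★★ `decayWeighted_classSum_le_card_mul` — THE DECAY-WEIGHTED MASS OF A SLOT IS `O(|R_A|)`: for any tuple class (tuples anywhere in
  `J`) and a summand `≤ A'·e^{−c·d(Δ)}·e^{−c₂·ρ(Δ₀)}`, `Σ_pΣ_{Δ∈cls p}Σ_n w ≤ A'·(|R_A|·K(c₂,d))·Σ_p|admissible p D|·K(c/p,d)^{p−1}`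
  (`Finset.sum_fiberwise` by the anchor + `…Eq524.sum_exp_anchored_le` + §1).

HONEST SCOPE / NOT HERE.  Counting only; the pairing with `…TupleClustersDecay` / `…AnchoredColourings` / `…SlotMasses` and the error
collection are the assembly's (`…Sect5FreeStep`, n08-b); `BasicLemmaPrinted` stays OPEN.  NOT summit progress; count-neutral for N08;
nothing of [Balaban1985UV3] is asserted.
-/

open Finset
open scoped BigOperators

namespace Literature.MathematicalPhysics.QuantumFieldTheory.Balaban1983to89.B1Eq324BenfattoSect5RegionCount

open Literature.MathematicalPhysics.QuantumFieldTheory.Balaban1983to89.B1Eq324BenfattoLemma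
open Literature.MathematicalPhysics.QuantumFieldTheory.Balaban1983to89.B1Eq324BenfattoSect5CrossCount (sum_exp_neg_mul_l1_le)
open Literature.MathematicalPhysics.QuantumFieldTheory.Balaban1983to89.B1Eq324BenfattoSect5Eq524
  (sum_exp_anchored_le card_filter_coe_mem_le)

variable {d : ℕ}

/-- **THE LATTICE SUM ANCHORED AT A REGION**: for `c > 0`, finite `F, R ⊂ ℤ^d` and a function `ρ` such that every `y ∈ F` has some
`x ∈ R` with `ℓ¹(x, y) ≤ ρ(y)` (e.g. `ρ = dist(·, R)`), `Σ_{y∈F} e^{−c·ρ(y)} ≤ |R|·(2/(1−e^{−c/√d})·e^{c/√d})^d` — uniformly in `F`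
(`e^{−cρ(y)} ≤ Σ_{x∈R} e^{−cℓ¹(x,y)}`, swap the sums, `…CrossCount.sum_exp_neg_mul_l1_le`). [cite: BenfattoEtAl1978, §5 p.159] -/
theorem sum_exp_neg_mul_le_card_mul {c : ℝ} (hc : 0 < c) (F R : Finset (B1Eq324BenfattoLemma.Site d))
    (ρ : B1Eq324BenfattoLemma.Site d → ℝ)
    (hρ : ∀ y ∈ F, ∃ x ∈ R, (∑ j, |((x j : ℝ) - (y j : ℝ))|) ≤ ρ y) :
    ∑ y ∈ F, Real.exp (-(c * ρ y)) ≤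
      R.card * (2 / (1 - Real.exp (-(c / Real.sqrt d))) * Real.exp (c / Real.sqrt d)) ^ d := by
  have hstep : ∀ y ∈ F, Real.exp (-(c * ρ y)) ≤ ∑ x ∈ R, Real.exp (-(c * ∑ j, |((x j : ℝ) - (y j : ℝ))|)) := by
    intro y hy
    obtain ⟨x, hx, hxy⟩ := hρ y hy
    have h1 : Real.exp (-(c * ρ y)) ≤ Real.exp (-(c * ∑ j, |((x j : ℝ) - (y j : ℝ))|)) :=
      Real.exp_le_exp.2 (neg_le_neg (mul_le_mul_of_nonneg_left hxy hc.le))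
    have h2 : Real.exp (-(c * ∑ j, |((x j : ℝ) - (y j : ℝ))|)) ≤
        ∑ x ∈ R, Real.exp (-(c * ∑ j, |((x j : ℝ) - (y j : ℝ))|)) :=
      Finset.single_le_sum (f := fun x : B1Eq324BenfattoLemma.Site d => Real.exp (-(c * ∑ j, |((x j : ℝ) - (y j : ℝ))|)))
        (fun x _ => (Real.exp_pos _).le) hx
    exact h1.trans h2
  calc ∑ y ∈ F, Real.exp (-(c * ρ y)) ≤ ∑ y ∈ F, ∑ x ∈ R, Real.exp (-(c * ∑ j, |((x j : ℝ) - (y j : ℝ))|)) :=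
        Finset.sum_le_sum hstep
    _ = ∑ x ∈ R, ∑ y ∈ F, Real.exp (-(c * ∑ j, |((x j : ℝ) - (y j : ℝ))|)) := Finset.sum_comm
    _ ≤ ∑ _x ∈ R, (2 / (1 - Real.exp (-(c / Real.sqrt d))) * Real.exp (c / Real.sqrt d)) ^ d :=
        Finset.sum_le_sum fun x _ => sum_exp_neg_mul_l1_le hc F x
    _ = R.card * (2 / (1 - Real.exp (-(c / Real.sqrt d))) * Real.exp (c / Real.sqrt d)) ^ d := by
        rw [Finset.sum_const, nsmul_eq_mul]

/-- **THE `n`-TUPLE FORM ANCHORED AT A REGION** («max ≥ mean» as in `…CrossCount.sum_piFinset_exp_neg_mul_le_pow`): for `c > 0`, `n ≥ 1`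
and `ρ` on `n`-tuples such that for every `y ∈ F^n` and every `i` some `x ∈ R` has `ℓ¹(x, y_i) ≤ ρ(y)` (e.g. the distance to `R` of the
FARTHEST `y_i`), `Σ_{y∈F^n} e^{−c·ρ(y)} ≤ (|R|·K(c/n, d))^n` — uniformly in `F`. [cite: BenfattoEtAl1978, §5 p.159] -/
theorem sum_piFinset_exp_neg_mul_le_card_mul_pow {c : ℝ} (hc : 0 < c) {n : ℕ} (hn : 1 ≤ n)
    (F R : Finset (B1Eq324BenfattoLemma.Site d)) (ρ : (Fin n → B1Eq324BenfattoLemma.Site d) → ℝ)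
    (hρ : ∀ y ∈ Fintype.piFinset (fun _ : Fin n => F), ∀ i, ∃ x ∈ R, (∑ j, |((x j : ℝ) - (y i j : ℝ))|) ≤ ρ y) :
    ∑ y ∈ Fintype.piFinset (fun _ : Fin n => F), Real.exp (-(c * ρ y)) ≤
      (R.card * ((2 / (1 - Real.exp (-(c / n / Real.sqrt d))) * Real.exp (c / n / Real.sqrt d)) ^ d)) ^ n := by
  have hn0 : (0 : ℝ) < n := by exact_mod_cast hn
  have hcn : 0 < c / n := div_pos hc hn0
  -- one-tessera weight summed over the region
  set g : B1Eq324BenfattoLemma.Site d → ℝ := fun z => ∑ x ∈ R, Real.exp (-(c / n * ∑ j, |((x j : ℝ) - (z j : ℝ))|)) with hg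
  have hg0 : ∀ z, 0 ≤ g z := fun z => Finset.sum_nonneg fun x _ => (Real.exp_pos _).le
  have hstep : ∀ y ∈ Fintype.piFinset (fun _ : Fin n => F), Real.exp (-(c * ρ y)) ≤ ∏ i, g (y i) := by
    intro y hy
    have h1 : Real.exp (-(c * ρ y)) = ∏ _i : Fin n, Real.exp (-(c / n * ρ y)) := by
      rw [Finset.prod_const, Finset.card_univ, Fintype.card_fin, ← Real.exp_nat_mul]
      congr 1
      field_simp
    rw [h1]
    refine Finset.prod_le_prod (fun i _ => (Real.exp_pos _).le) fun i _ => ?_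
    obtain ⟨x, hx, hxy⟩ := hρ y hy i
    have h2 : Real.exp (-(c / n * ρ y)) ≤ Real.exp (-(c / n * ∑ j, |((x j : ℝ) - (y i j : ℝ))|)) :=
      Real.exp_le_exp.2 (neg_le_neg (mul_le_mul_of_nonneg_left hxy hcn.le))
    have h3 : Real.exp (-(c / n * ∑ j, |((x j : ℝ) - (y i j : ℝ))|)) ≤ g (y i) :=
      Finset.single_le_sum (f := fun x : B1Eq324BenfattoLemma.Site d =>
        Real.exp (-(c / n * ∑ j, |((x j : ℝ) - (y i j : ℝ))|))) (fun x _ => (Real.exp_pos _).le) hx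
    exact h2.trans h3
  calc ∑ y ∈ Fintype.piFinset (fun _ : Fin n => F), Real.exp (-(c * ρ y))
      ≤ ∑ y ∈ Fintype.piFinset (fun _ : Fin n => F), ∏ i, g (y i) := Finset.sum_le_sum hstep
    _ = (∑ z ∈ F, g z) ^ n := (Finset.sum_pow' F g n).symm
    _ ≤ (R.card * ((2 / (1 - Real.exp (-(c / n / Real.sqrt d))) * Real.exp (c / n / Real.sqrt d)) ^ d)) ^ n := by
        refine pow_le_pow_left₀ (Finset.sum_nonneg fun z _ => hg0 z) ?_ n
        calc ∑ z ∈ F, g z = ∑ x ∈ R, ∑ z ∈ F, Real.exp (-(c / n * ∑ j, |((x j : ℝ) - (z j : ℝ))|)) := Finset.sum_comm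
          _ ≤ ∑ _x ∈ R, ((2 / (1 - Real.exp (-(c / n / Real.sqrt d))) * Real.exp (c / n / Real.sqrt d)) ^ d) :=
              Finset.sum_le_sum fun x _ => sum_exp_neg_mul_l1_le hcn F x
          _ = R.card * ((2 / (1 - Real.exp (-(c / n / Real.sqrt d))) * Real.exp (c / n / Real.sqrt d)) ^ d) := by
              rw [Finset.sum_const, nsmul_eq_mul]

/-- **THE DECAY-WEIGHTED MASS OF A SLOT IS `O(|R_A|)`, UNIFORMLY IN THE VOLUME**: for any tuple class `cls p ⊆ (Fin p → J)` (tuples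
ANYWHERE in `J`) and a summand dominated by `A'·e^{−c·d(Δ)}·e^{−c₂·ρ(Δ₀)}` (`c, c₂ > 0`, `A' ≥ 0`; `Δ₀` the anchor tessera) with `ρ` dominating
the `ℓ¹` distance to some tessera of `R_A` (e.g. `ρ = dist(·, R_A)`),
`Σ_{p∈Icc 1 s}Σ_{Δ∈cls p}Σ_{n∈admissible p D} w ≤ A'·(|R_A|·K(c₂,d))·Σ_{p∈Icc 1 s}|admissible p D|·K(c/p,d)^{p−1}` — group the tuples by their
anchor (`Finset.sum_fiberwise`), sum the other tesserae freely (`…Eq524.sum_exp_anchored_le` at `R = {anchor}`), then sum the anchors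
against the weight (`sum_exp_neg_mul_le_card_mul`).  This is the bound that makes the weighted masses of
`…TupleClustersDecay.abs_ursellOf_tupleSums_condField_le_prod_decayMass` volume-independent. [cite: BenfattoEtAl1978, §5 p.159 and (5.29) p.158] -/
theorem decayWeighted_classSum_le_card_mul {s D : ℕ} {Jr : Finset (B1Eq324BenfattoLemma.Site d)} {c c₂ A' : ℝ}
    (hc : 0 < c) (hc₂ : 0 < c₂) (hA' : 0 ≤ A') (cls : (p : ℕ) → Finset (Fin p → Jr))
    (RA : Finset (B1Eq324BenfattoLemma.Site d)) (ρ : B1Eq324BenfattoLemma.Site d → ℝ)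
    (hρ : ∀ y ∈ Jr, ∃ x ∈ RA, (∑ j, |((x j : ℝ) - (y j : ℝ))|) ≤ ρ y)
    (w : (p : ℕ) → (Fin p → Jr) → (Fin p → ℕ) → ℝ)
    (hw : ∀ (p : ℕ) (hp : p ∈ Finset.Icc 1 s), ∀ Δ ∈ cls p, ∀ n ∈ admissible p D,
      w p Δ n ≤ A' * Real.exp (-(c * connLength fun i => (Δ i : B1Eq324BenfattoLemma.Site d))) *
        Real.exp (-(c₂ * ρ (Δ ⟨0, (Finset.mem_Icc.1 hp).1⟩ : B1Eq324BenfattoLemma.Site d)))) :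
    ∑ p ∈ Finset.Icc 1 s, ∑ Δ ∈ cls p, ∑ n ∈ admissible p D, w p Δ n ≤
      A' * (RA.card * (2 / (1 - Real.exp (-(c₂ / Real.sqrt d))) * Real.exp (c₂ / Real.sqrt d)) ^ d) *
        ∑ p ∈ Finset.Icc 1 s, ((admissible p D).card : ℝ) *
          ((2 / (1 - Real.exp (-(c / (p : ℕ) / Real.sqrt d))) * Real.exp (c / (p : ℕ) / Real.sqrt d)) ^ d) ^ (p - 1) := by
  classical
  set KA : ℝ := RA.card * (2 / (1 - Real.exp (-(c₂ / Real.sqrt d))) * Real.exp (c₂ / Real.sqrt d)) ^ d with hKA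
  -- the anchor sum: `Σ_{y∈J} e^{−c₂ρ(y)} ≤ |R_A|·K(c₂)`
  have hanchor : ∑ y ∈ Jr, Real.exp (-(c₂ * ρ y)) ≤ KA := sum_exp_neg_mul_le_card_mul hc₂ Jr RA ρ hρ
  have hKA0 : 0 ≤ KA := (Finset.sum_nonneg fun y _ => (Real.exp_pos _).le).trans hanchor
  rw [Finset.mul_sum]
  refine Finset.sum_le_sum fun p hp => ?_
  have hp1 : 1 ≤ p := (Finset.mem_Icc.1 hp).1
  obtain ⟨p', rfl⟩ := Nat.exists_eq_succ_of_ne_zero (Nat.one_le_iff_ne_zero.1 hp1)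
  simp only [Nat.succ_eq_add_one, Nat.add_sub_cancel]
  set K : ℝ := ((2 / (1 - Real.exp (-(c / ((p' + 1 : ℕ) : ℝ) / Real.sqrt d))) *
    Real.exp (c / ((p' + 1 : ℕ) : ℝ) / Real.sqrt d)) ^ d) with hK
  have hK0 : 0 ≤ K := pow_nonneg (mul_nonneg (div_nonneg zero_le_two (by
    rw [sub_nonneg, Real.exp_le_one_iff, neg_nonpos]; positivity)) (Real.exp_pos _).le) _
  -- the weight of a tuple: coefficient decay times the anchor weight
  set F : (Fin (p' + 1) → Jr) → ℝ := fun Δ =>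
    Real.exp (-(c * connLength fun i => (Δ i : B1Eq324BenfattoLemma.Site d))) *
      Real.exp (-(c₂ * ρ (Δ 0 : B1Eq324BenfattoLemma.Site d))) with hF
  have hF0 : ∀ Δ, 0 ≤ F Δ := fun Δ => mul_nonneg (Real.exp_pos _).le (Real.exp_pos _).le
  -- per tuple
  have h1 : ∑ Δ ∈ cls (p' + 1), ∑ n ∈ admissible (p' + 1) D, w (p' + 1) Δ n ≤
      ((admissible (p' + 1) D).card : ℝ) * A' * ∑ Δ : Fin (p' + 1) → Jr, F Δ := by
    calc ∑ Δ ∈ cls (p' + 1), ∑ n ∈ admissible (p' + 1) D, w (p' + 1) Δ n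
        ≤ ∑ Δ ∈ cls (p' + 1), ((admissible (p' + 1) D).card : ℝ) * (A' * F Δ) := by
          refine Finset.sum_le_sum fun Δ hΔ => ?_
          refine (Finset.sum_le_card_nsmul _ _ (A' * F Δ) fun n hn => ?_).trans (by rw [nsmul_eq_mul])
          have h := hw (p' + 1) hp Δ hΔ n hn
          simp only [hF]
          rw [← mul_assoc]
          exact h
      _ ≤ ∑ Δ : Fin (p' + 1) → Jr, ((admissible (p' + 1) D).card : ℝ) * (A' * F Δ) :=
          Finset.sum_le_sum_of_subset_of_nonneg (Finset.subset_univ _) fun Δ _ _ =>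
            mul_nonneg (Nat.cast_nonneg _) (mul_nonneg hA' (hF0 Δ))
      _ = ((admissible (p' + 1) D).card : ℝ) * A' * ∑ Δ : Fin (p' + 1) → Jr, F Δ := by
          rw [Finset.mul_sum]; exact Finset.sum_congr rfl fun Δ _ => by ring
  -- group by the anchor and sum the other tesserae freely
  have h2 : ∑ Δ : Fin (p' + 1) → Jr, F Δ ≤ KA * K ^ p' := by
    rw [← Finset.sum_fiberwise (Finset.univ : Finset (Fin (p' + 1) → Jr)) (fun Δ => Δ 0) F]
    have hfib : ∀ y : Jr, ∑ Δ ∈ (Finset.univ : Finset (Fin (p' + 1) → Jr)).filter (fun Δ => Δ 0 = y), F Δ ≤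
        Real.exp (-(c₂ * ρ (y : B1Eq324BenfattoLemma.Site d))) * K ^ p' := by
      intro y
      have hcongr : ∑ Δ ∈ (Finset.univ : Finset (Fin (p' + 1) → Jr)).filter (fun Δ => Δ 0 = y), F Δ =
          Real.exp (-(c₂ * ρ (y : B1Eq324BenfattoLemma.Site d))) *
            ∑ Δ ∈ (Finset.univ : Finset (Fin (p' + 1) → Jr)).filter (fun Δ => Δ 0 = y),
              Real.exp (-(c * connLength fun i => (Δ i : B1Eq324BenfattoLemma.Site d))) := by
        rw [Finset.mul_sum]
        refine Finset.sum_congr rfl fun Δ hΔ => ?_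
        simp only [hF]
        rw [(Finset.mem_filter.1 hΔ).2, mul_comm]
      rw [hcongr]
      refine mul_le_mul_of_nonneg_left ?_ (Real.exp_pos _).le
      have hsub : (Finset.univ : Finset (Fin (p' + 1) → Jr)).filter (fun Δ => Δ 0 = y) ⊆
          (Finset.univ : Finset (Fin (p' + 1) → Jr)).filter
            (fun Δ => ((Δ 0 : Jr) : B1Eq324BenfattoLemma.Site d) ∈ ({(y : B1Eq324BenfattoLemma.Site d)} : Finset _)) := by
        intro Δ hΔ
        refine Finset.mem_filter.2 ⟨Finset.mem_univ _, ?_⟩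
        rw [(Finset.mem_filter.1 hΔ).2, Finset.mem_singleton]
      refine (Finset.sum_le_sum_of_subset_of_nonneg hsub fun Δ _ _ => (Real.exp_pos _).le).trans ?_
      refine (sum_exp_anchored_le (J := Jr) hc p' {(y : B1Eq324BenfattoLemma.Site d)}).trans ?_
      have hcard : (((Finset.univ : Finset {x // x ∈ Jr}).filter fun x : {x // x ∈ Jr} =>
          x.1 ∈ ({(y : B1Eq324BenfattoLemma.Site d)} : Finset _)).card : ℝ) ≤ 1 := by
        have := card_filter_coe_mem_le (J := Jr) ({(y : B1Eq324BenfattoLemma.Site d)} : Finset _)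
        rw [Finset.card_singleton] at this
        exact_mod_cast this
      calc _ ≤ 1 * K ^ p' := mul_le_mul_of_nonneg_right hcard (pow_nonneg hK0 _)
        _ = K ^ p' := one_mul _
    calc ∑ y : Jr, ∑ Δ ∈ (Finset.univ : Finset (Fin (p' + 1) → Jr)).filter (fun Δ => Δ 0 = y), F Δ
        ≤ ∑ y : Jr, Real.exp (-(c₂ * ρ (y : B1Eq324BenfattoLemma.Site d))) * K ^ p' := Finset.sum_le_sum fun y _ => hfib y
      _ = (∑ y ∈ Jr, Real.exp (-(c₂ * ρ y))) * K ^ p' := by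
          rw [← Finset.sum_mul, Finset.sum_coe_sort Jr (fun y => Real.exp (-(c₂ * ρ y)))]
      _ ≤ KA * K ^ p' := mul_le_mul_of_nonneg_right hanchor (pow_nonneg hK0 _)
  calc ∑ Δ ∈ cls (p' + 1), ∑ n ∈ admissible (p' + 1) D, w (p' + 1) Δ n
      ≤ ((admissible (p' + 1) D).card : ℝ) * A' * (KA * K ^ p') :=
        h1.trans (mul_le_mul_of_nonneg_left h2 (mul_nonneg (Nat.cast_nonneg _) hA'))
    _ = A' * KA * (((admissible (p' + 1) D).card : ℝ) * K ^ p') := by ring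

end Literature.MathematicalPhysics.QuantumFieldTheory.Balaban1983to89.B1Eq324BenfattoSect5RegionCount
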